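import Summits.NavierStokesRegularity.NavierStokesRegularity.Theses.QuantisedSymmetry
import Summits.NavierStokesRegularity.NavierStokesRegularity.Theorems.QuantisedSymmetryPolyhedralTruncationBridge
import Summits.NavierStokesRegularity.NavierStokesRegularity.Theorems.QuantisedSymmetryLiouvilleKillsProfile
import Summits.NavierStokesRegularity.NavierStokesRegularity.Theses.Blowup
import Summits.NavierStokesRegularity.NavierStokesRegularity.Theorems.DssFarFieldSlavingBlowupTypeIDssProfileFixedTwistEmpty
import Summits.NavierStokesRegularity.NavierStokesRegularity.Theorems.DssFarFieldSlavingBlowupTypeIDssProfileGaussianSmallTypeI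
import Literature.Analysis.FluidPDE.SelfSimilarLiouville
import Literature.Analysis.FluidPDE.AncientAxisymmetricTypeILiouville

/-!
# Strategist census companion (seat cstrat s22-g6, family `-s`, independent census) for the crux
`Theses.QuantisedSymmetry.PolyhedralDssProfileExists` (stmt-NavierStokesRegularity-1404).

Kernel-checked facts used by `STRATEGY-CENSUS-s22.md`:

* `crux_decides` — the crux ALONE proves `¬ NavierStokesRegularity` (the other two binders of the
  route's deciding theorem `closes` are tree theorems): the crux is summit-deciding.
* `crux_imp_not_typeIDSSLiouville`, `crux_imp_blowupTypeIDssProfile`,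
  `crux_imp_not_polyhedralTypeILiouville` — the summit-down chain of strictly weaker typed
  consequences: each is another route's ∃-crux / the negation of this route's kill switch.
* `witness_typeI_constant_gt`, `witness_factor_not_near_one`, `witness_not_axisymmetric_conj` —
  every strengthening S⁺ with analytic pay-off lands in a cell the tree already proves EMPTY.
* `SplitL_*` — the best typed decomposition (Liouville-failure ∧ closing lemma) and its trivial
  assembly; the census explains why neither piece has a plan.
-/

set_option linter.dupNamespace false

namespace Summit.NavierStokesRegularity.NavierStokesRegularity.Cruxes.PolyhedralDssProfileExists.CensusS22g6

open MeasureTheory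
open Literature.Analysis.FluidPDE
open Summit.NavierStokesRegularity.NavierStokesRegularity.Theses.QuantisedSymmetry
open Summit.NavierStokesRegularity.NavierStokesRegularity.Theorems

local notation "E3" => EuclideanSpace ℝ (Fin 3)

/-! ## 1. The crux is summit-deciding on its own -/

/-- The crux alone refutes the Clay statement: `closes` with its two other binders discharged by
the tree theorems `quantisedSymmetry_polyhedralTruncationBridge_proof` (stmt-11331) and
`ClayUniqueness_holds` (stmt-0153). -/
theorem crux_decides (h : PolyhedralDssProfileExists) : ¬ _root_.NavierStokesRegularity :=
  closes h quantisedSymmetry_polyhedralTruncationBridge_proof ClayUniqueness_holds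

/-! ## 2. Summit-down: the typed strictly-weaker consequences -/

/-- Crux ⇒ Tsai's Type-I `λ`-DSS Liouville statement fails for the witness's factor
(Bradshaw–Tsai 2017 Open Problem 5.1 answered negatively). -/
theorem crux_imp_not_typeIDSSLiouville (h : PolyhedralDssProfileExists) :
    ∃ c : ℝ, 1 < c ∧ ¬ TypeIDSSLiouville c := by
  obtain ⟨G, -, -, -, c, hc, u, hanc, hmeas, hdss, hdec, -, hnt⟩ := h
  exact ⟨c, hc, fun hL => hnt (hL hc u hanc hmeas hdss hdec)⟩

/-- Crux ⇒ the sibling ∃-crux `Blowup.BlowupTypeIDssProfile` (stmt-NavierStokesRegularity-0155,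
shared with route DssFarFieldSlaving): the symmetry-free Type-I (R)DSS profile. -/
theorem crux_imp_blowupTypeIDssProfile (h : PolyhedralDssProfileExists) :
    Theses.Blowup.BlowupTypeIDssProfile := by
  obtain ⟨c, -, hL⟩ := crux_imp_not_typeIDSSLiouville h
  exact fun hall => hL (hall c).1

/-- Crux ⇒ failure of the route's kill switch `PolyhedralTypeILiouville` (stmt-1405), by the
PROVED glue `LiouvilleKillsProfile` (stmt-1408). -/
theorem crux_imp_not_polyhedralTypeILiouville (h : PolyhedralDssProfileExists) :
    ¬ PolyhedralTypeILiouville :=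
  fun hL => quantisedSymmetry_liouvilleKillsProfile_proof hL h

/-! ## 3. Strengthenings: every cell with analytic pay-off is proved empty in the tree -/

/-- Any witness has Type-I constant `C₀ > 8/25` (tree: explicit small-constant Liouville slice
`GaussianGap.rdssClass_empty_of_typeI_le`, Chae–Wolf 2017 Rmk 1.4 made explicit). -/
theorem witness_typeI_constant_gt {c C₀ : ℝ} (hc : 1 < c) {u : ℝ → E3 → E3}
    (hanc : IsAncientMildSolution 1 u) (hmeas : ∀ t < 0, AEStronglyMeasurable (u t) volume)
    (hdss : IsDiscretelySelfSimilar c u) (hdec : HasTypeIDecay C₀ u)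
    (hnt : ¬ ∀ t < 0, u t =ᵐ[volume] 0) : 8 / 25 < C₀ := by
  by_contra hle
  exact GaussianGap.rdssClass_empty_of_typeI_le (le_of_not_gt hle)
    ⟨c, LinearIsometryEquiv.refl ℝ E3, u, hc, hanc, hmeas, isRotatedDSS_refl_iff.mpr hdss, hdec, hnt⟩

/-- The near-identity cell is empty: for every Type-I constant `M` there is `c₁(M) > 1` below
which no `c`-DSS Type-I ancient profile exists (tree: `FixedTwistEmpty.rdssClass_fixedTwist_nearIdentity_ae_zero`
at `R = 1` = Chae–Wolf 2017 Thm 1.3 = Pineau–Vicol 2026 Thm 1.6, class level). -/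
theorem witness_factor_not_near_one (M : ℝ) (hM : 0 < M) :
    ∃ c₁ : ℝ, 1 < c₁ ∧ ∀ c : ℝ, 1 < c → c < c₁ → ∀ u : ℝ → E3 → E3,
      IsAncientMildSolution 1 u → (∀ t < 0, AEStronglyMeasurable (u t) volume) →
      IsDiscretelySelfSimilar c u → HasTypeIDecay M u → ∀ t < 0, u t =ᵐ[volume] 0 := by
  obtain ⟨c₁, hc₁, h⟩ :=
    FixedTwistEmpty.rdssClass_fixedTwist_nearIdentity_ae_zero M hM (LinearIsometryEquiv.refl ℝ E3)
  exact ⟨c₁, hc₁, fun c hc hcc u hanc hmeas hdss hdec =>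
    h c hc hcc u hanc hmeas (isRotatedDSS_refl_iff.mpr hdss) hdec⟩

/-- No witness is axisymmetric about any axis (tree: KNSS 2009 Thm 5.3 via
`IsAncientMildSolution.ae_eq_zero_of_isAxisymmetric_conj_of_hasTypeIDecay`): the only symmetry
reductions with a Liouville/ODE pay-off (continuous stabiliser) are closed to this crux. -/
theorem witness_not_axisymmetric_conj {u : ℝ → E3 → E3}
    (hanc : IsAncientMildSolution 1 u) (hmeas : ∀ t < 0, AEStronglyMeasurable (u t) volume)
    (hdec : ∃ C₀ : ℝ, HasTypeIDecay C₀ u) (hnt : ¬ ∀ t < 0, u t =ᵐ[volume] 0)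
    (A : E3 ≃ₗᵢ[ℝ] E3) : ¬ ∀ t < 0, IsAxisymmetric (fun x => A.symm (u t (A x))) := by
  intro hax
  obtain ⟨C₀, hC⟩ := hdec
  exact hnt (hanc.ae_eq_zero_of_isAxisymmetric_conj_of_hasTypeIDecay hmeas A hax hC)

/-! ## 4. The best typed decomposition (Split L) and why it is not a redirect -/

/-- Piece L1 (strictly weaker than the crux, by `crux_imp_not_polyhedralTypeILiouville`): the
polyhedral Type-I Liouville statement FAILS — some finite irreducible rotation group admits a
nontrivial BOUNDED ancient mild Type-I G-equivariant solution (no self-similarity). -/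
def SplitL1 : Prop := ¬ PolyhedralTypeILiouville

/-- Piece L2 (the "closing lemma"): a non-Liouville polyhedral Type-I ancient solution can be
upgraded to a DISCRETELY SELF-SIMILAR one. Implied by the crux (its conclusion is the crux); no
mechanism known (recurrent ⇒ periodic is false in general dynamics). -/
def SplitL2 : Prop := ¬ PolyhedralTypeILiouville → PolyhedralDssProfileExists

/-- The assembly of Split L is modus ponens. -/
theorem splitL_assembly (h1 : SplitL1) (h2 : SplitL2) : PolyhedralDssProfileExists := h2 h1

/-- Both pieces are implied by the crux (so the split loses nothing) … -/
theorem splitL_of_crux (h : PolyhedralDssProfileExists) : SplitL1 ∧ SplitL2 :=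
  ⟨crux_imp_not_polyhedralTypeILiouville h, fun _ => h⟩

end Summit.NavierStokesRegularity.NavierStokesRegularity.Cruxes.PolyhedralDssProfileExists.CensusS22g6
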